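import Summits.Langlands.Langlands.Theorems.SqrtFiveQuarticCoversReductionToRefinedLocusStubFiveSpanOdd
import Summits.Langlands.Langlands.Theorems.SqrtFiveQuarticCoversReductionToRefinedLocusStubBoxThreeSeven
import Summits.Langlands.Langlands.Theorems.SqrtFiveQuarticCoversGroupCensusFive

/-!
# Route `SqrtFiveQuarticCovers`, crux `ReductionToRefinedLocus` (stmt-Langlands-17834): the LINE
# `birth` composed in the tree — the crux from its two OPEN registered stubs, and hence from the two
# printed theorems `FLS2015_theorem3` + `Box2022_theorem1_3`

The registered skeleton `Cruxes/ReductionToRefinedLocus/Lines/birth.lean` (sha e9db0923…) has four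
stubs and a sorry-free glue `ReductionToRefinedLocus_of_stubs`.  Two stubs are LANDED by name
(`GroupCensusFive.stub_detSqrtFive`, `GroupCensusFive.stub_censusTrichotomy`, p652735); the other two
(`stub_boxThreeSeven` = Box 2022 Thm. 1.3 (i),(iii); `stub_fiveSpanOdd` = FLS 2015 Thm. 3 at `p = 5` in
census form) are printed modularity-lifting theorems, landed only CONDITIONALLY
(`stub_boxThreeSeven_of_Box2022_theorem1_3`, `stub_fiveSpanOdd_of_FLS2015_theorem3`; this seat).

* `reductionToRefinedLocus_of_lineBirth_stubs` — the skeleton's glue, Theorems-side: the two open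
  stub STATEMENTS (verbatim, as hypotheses) imply the crux BY NAME, the other two stubs being supplied
  by their landed theorems; the change of framing is the tree's `FLS2015.isTorsionGaloisRep_conj`.
* `reductionToRefinedLocus_of_FLS2015_theorem3_of_Box2022_theorem1_3` — hence the crux modulo EXACTLY
  the two printed theorems the open stubs abbreviate (`FLS2015_theorem3`, `Box2022_theorem1_3`); the
  tree's earlier `GroupCensusFive.reductionToRefinedLocus_of_liftingTheorems` used the three lifting
  inputs of Box's Thm. 7.1 (`FLS2015_theorem3`, `FLS2015_theorem4`, `Kalyanswamy2018_theorem1_2`).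

HONEST STATUS: CONDITIONAL (`proof.conditional`); the crux item stays open — its two open stubs ARE
printed automorphy theorems with no carrier in the tree (N3); nothing here proves modularity of any
curve.  `--supports` stmt-Langlands-17834.

References: [FreitasLeHungSiksek2015] Thm. 3, Remark (iii) after Cor. 2.1; [Box2022] Thms. 1.3, 7.1.
-/

set_option linter.dupNamespace false -- project-wide option; `Summit.Langlands.Langlands` is the mandated namespace

noncomputable section

namespace Summit.Langlands.Langlands.Theorems.SqrtFiveQuarticCovers

open scoped NumberField Matrix
open Literature.NumberTheory.Automorphic Literature.NumberTheory.GaloisRepresentations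
open Summit.Langlands.Langlands.Theses.SqrtFiveQuarticCovers

/-- **Line `birth` of `ReductionToRefinedLocus`, composed in the tree.**  The two OPEN registered stub
statements `stub_boxThreeSeven` (`h37`) and `stub_fiveSpanOdd` (`h5`), verbatim as hypotheses, imply
the crux `ReductionToRefinedLocus` BY NAME: the `3`/`7` clauses are `h37`; for `5`, `h5` gives a
framing with an odd element and non-spanning determinant-one part, the LANDED stub
`GroupCensusFive.stub_detSqrtFive` gives `det ⊆ {±1}` (here `√5 ∈ K` enters), the LANDED stub
`GroupCensusFive.stub_censusTrichotomy` conjugates the image into `B`, `H8` or `H12`, and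
`FLS2015.isTorsionGaloisRep_conj` re-frames.  This is the skeleton's glue
`ReductionToRefinedLocus_of_stubs` with the two landed stubs plugged in. [folklore] -/
theorem reductionToRefinedLocus_of_lineBirth_stubs
    (h37 : ∀ (K : Type) [Field K] [NumberField K], NumberField.IsTotallyReal K → Module.finrank ℚ K = 4 → ∀ E : WeierstrassCurve (NumberField.RingOfIntegers K), E.Δ ≠ 0 → ¬ ((E.baseChange K).HasCM ∨ ∃ (hF : Literature.NumberTheory.Automorphic.isCompact_glFiniteIntegralLevel 2 K) (π : Literature.NumberTheory.Automorphic.CuspidalAutomorphicRepData 2 K hF), π.1.HasWeightZero ∧ ∀ᶠ w : IsDedekindDomain.HeightOneSpectrum (NumberField.RingOfIntegers K) in Filter.cofinite, ∃ α : Multiset ℂ, π.1.HasSatakeParamAt w α ∧ ((Real.sqrt w.residueCard : ℝ) : ℂ) * α.sum = (Literature.NumberTheory.Automorphic.frobTraceAt E w : ℂ)) → (∃ ρ : Literature.NumberTheory.GaloisRepresentations.FramedGaloisRep K (ZMod 3) 2, (∃ e : (E.baseChange K).geomTorsion ((3 : ℕ) : ℤ) ≃+ (Fin 2 → ZMod 3),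 ∀ (σ : Field.absoluteGaloisGroup K) (P : (E.baseChange K).geomTorsion ((3 : ℕ) : ℤ)), e (σ • P) = ((ρ σ : GL (Fin 2) (ZMod 3)) : Matrix (Fin 2) (Fin 2) (ZMod 3)) *ᵥ (e P)) ∧ ((∀ σ : Field.absoluteGaloisGroup K, (((ρ σ : GL (Fin 2) (ZMod 3)) : Matrix (Fin 2) (Fin 2) (ZMod 3)) 1 0 = 0)) ∨ (∀ σ : Field.absoluteGaloisGroup K, (ρ σ : GL (Fin 2) (ZMod 3)) ∈ Subgroup.closure ({(⟨!![1, 0; 0, 2], !![1, 0; 0, 2], by decide, by decide⟩ : GL (Fin 2) (ZMod 3)), (⟨!![0, 1; 1, 0], !![0, 1; 1, 0], by decide, by decide⟩ : GL (Fin 2) (ZMod 3))} : Set (GL (Fin 2) (ZMod 3)))))) ∧ (∃ ρ : Literature.NumberTheory.GaloisRepresentations.FramedGaloisRep K (ZMod 7) 2, (∃ e : (E.baseChange K).geomTorsion ((7 : ℕ) : ℤ) ≃+ (Fin 2 → ZMod 7), ∀ (σ : Field.absoluteGaloisGroup K) (P : (E.baseChange K).geomTorsion ((7 : ℕ) : ℤ)),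 e (σ • P) = ((ρ σ : GL (Fin 2) (ZMod 7)) : Matrix (Fin 2) (Fin 2) (ZMod 7)) *ᵥ (e P)) ∧ ((∀ σ : Field.absoluteGaloisGroup K, (((ρ σ : GL (Fin 2) (ZMod 7)) : Matrix (Fin 2) (Fin 2) (ZMod 7)) 1 0 = 0)) ∨ (∀ σ : Field.absoluteGaloisGroup K, (ρ σ : GL (Fin 2) (ZMod 7)) ∈ Subgroup.closure ({(⟨!![0, 5; 3, 0], !![0, 5; 3, 0], by decide, by decide⟩ : GL (Fin 2) (ZMod 7)), (⟨!![5, 0; 3, 2], !![3, 0; 6, 4], by decide, by decide⟩ : GL (Fin 2) (ZMod 7))} : Set (GL (Fin 2) (ZMod 7)))))))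
    (h5 : ∀ (K : Type) [Field K] [NumberField K], NumberField.IsTotallyReal K → ∀ E : WeierstrassCurve (NumberField.RingOfIntegers K), E.Δ ≠ 0 → ¬ ((E.baseChange K).HasCM ∨ ∃ (hF : Literature.NumberTheory.Automorphic.isCompact_glFiniteIntegralLevel 2 K) (π : Literature.NumberTheory.Automorphic.CuspidalAutomorphicRepData 2 K hF), π.1.HasWeightZero ∧ ∀ᶠ w : IsDedekindDomain.HeightOneSpectrum (NumberField.RingOfIntegers K) in Filter.cofinite, ∃ α : Multiset ℂ, π.1.HasSatakeParamAt w α ∧ ((Real.sqrt w.residueCard : ℝ) : ℂ) * α.sum = (Literature.NumberTheory.Automorphic.frobTraceAt E w : ℂ)) → ∃ ρ : Literature.NumberTheory.GaloisRepresentations.FramedGaloisRep K (ZMod 5) 2, (∃ e : (E.baseChange K).geomTorsion ((5 : ℕ) : ℤ) ≃+ (Fin 2 → ZMod 5), ∀ (σ : Field.absoluteGaloisGroup K) (P : (E.baseChange K).geomTorsion ((5 : ℕ) : ℤ)), e (σ • P) = ((ρ σ : GL (Fin 2) (ZMod 5)) : Matrix (Fin 2) (Fin 2) (ZMod 5)) *ᵥ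 (e P)) ∧ (∃ σ : Field.absoluteGaloisGroup K, Matrix.trace ((ρ σ : GL (Fin 2) (ZMod 5)) : Matrix (Fin 2) (Fin 2) (ZMod 5)) = 0 ∧ Matrix.det ((ρ σ : GL (Fin 2) (ZMod 5)) : Matrix (Fin 2) (Fin 2) (ZMod 5)) = -1) ∧ Submodule.span (ZMod 5) ((fun g : GL (Fin 2) (ZMod 5) => ((g : GL (Fin 2) (ZMod 5)) : Matrix (Fin 2) (Fin 2) (ZMod 5))) '' {g : GL (Fin 2) (ZMod 5) | g ∈ ρ.toMonoidHom.range ∧ Matrix.det ((g : GL (Fin 2) (ZMod 5)) : Matrix (Fin 2) (Fin 2) (ZMod 5)) = 1}) ≠ ⊤) :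
    ReductionToRefinedLocus := by
  intro K _ _ hK hdeg h5K E hE hne
  obtain ⟨h3, h7⟩ := h37 K hK hdeg E hE hne
  obtain ⟨ρ, hfr, ⟨σ₀, htr, hdet₀⟩, hspan⟩ := h5 K hK E hE hne
  have hdetρ := GroupCensusFive.stub_detSqrtFive K h5K E hE ρ hfr
  obtain ⟨x, hx⟩ := GroupCensusFive.stub_censusTrichotomy ρ.toMonoidHom.range
    (by rintro _ ⟨σ, rfl⟩; exact hdetρ σ) ⟨ρ σ₀, ⟨σ₀, rfl⟩, htr, hdet₀⟩ hspan
  have hfr' : (E.baseChange K).IsTorsionGaloisRep 5 (FramedRep.conj x ρ) :=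
    FLS2015.isTorsionGaloisRep_conj hfr x
  refine ⟨h3, ?_, h7⟩
  rcases hx with hB | hH8 | hH12
  · refine Or.inl ⟨FramedRep.conj x ρ, hfr', fun σ => ?_⟩
    rw [FramedRep.conj_apply]
    exact hB (ρ σ) ⟨σ, rfl⟩
  · refine Or.inr ⟨FramedRep.conj x ρ, hfr', Or.inl fun σ => ?_⟩
    rw [FramedRep.conj_apply]
    exact hH8 (ρ σ) ⟨σ, rfl⟩
  · refine Or.inr ⟨FramedRep.conj x ρ, hfr', Or.inr fun σ => ?_⟩
    rw [FramedRep.conj_apply]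
    exact hH12 (ρ σ) ⟨σ, rfl⟩

/-- **`ReductionToRefinedLocus` modulo `FLS2015_theorem3` and `Box2022_theorem1_3` only** — the line
`birth` closed modulo exactly the two printed theorems its open stubs abbreviate (FLS 2015 Thm. 3;
Box 2022 Thm. 1.3 (i),(iii)).  CONDITIONAL; closes nothing.
[cite: FreitasLeHungSiksek2015, Thm. 3] [cite: Box2022, Thm. 1.3] -/
theorem reductionToRefinedLocus_of_FLS2015_theorem3_of_Box2022_theorem1_3 (h3 : FLS2015_theorem3)
    (hBox : Box2022_theorem1_3) : ReductionToRefinedLocus :=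
  reductionToRefinedLocus_of_lineBirth_stubs (stub_boxThreeSeven_of_Box2022_theorem1_3 hBox)
    (stub_fiveSpanOdd_of_FLS2015_theorem3 h3)

end Summit.Langlands.Langlands.Theorems.SqrtFiveQuarticCovers

end
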